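import Literature.AlgebraicGeometry.Resolution.DecompletionPolydisc
import Literature.AlgebraicGeometry.Resolution.DecompletionHenselPoint
import HarnessLib

/-!
# Temkin's decompletion lemma, algebraic proof — X. The `K`-side bridge map `λ₀ : A″_j → E₀` and `Λ₀ : D₀ → E₁`

Topic: `Literature/AlgebraicGeometry/Resolution`. M. Temkin, *Inseparable local uniformization*,
J. Algebra 373 (2013) 65–119 = arXiv:0804.1554v3, Lemma 3.3.2 (tree: `Temkin2013_Lemma332_nft`).

For a polydisc chart `ε` tied to the Hensel chart at level `j` (`DecompChart.EHyps`: `j = j_z + c`,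
built-in units `s, h, t`, `r` above the `b`-exponents, `M ≥ e + N_a`) we construct the `K`-side
half of the bridge between the two charts:

* `preimE`, `lamSub`, `Aj_le_preimE` — every element of `A′_j = Nr_K(C_j)` has an honest
  preimage in `E₀` under `ψE` (closure for `C_j`; NORMALITY of the smooth `m°`-algebra `E₀`,
  `mem_range_of_isIntegral_tensor_fractionRing`, for the integral closure) — PROVED;
* `lam₀ : A″_j → E₀` through the two localizations (`IsLocalization.Away.lift`), with
  `ιE_lam₀ : ι_E ∘ λ₀ = ψ_E` on `A″_j ∩ Rh` and its values on `π, y, δ, ι` — PROVED;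
* the Newton root datum `ZE` (`π^{e+N_a} Z_E = (y₀ − y_E) ι_λ`), the Hensel root
  `ζE = y_E + π^e a_{y,E} Z_E` with `ι_E(ζ_E) = y₀`, hence `p(ζ_E) = 0` and `p_new(Z_E) = 0`
  (`aeval_ZE_pnewS`) — PROVED;
* the final polydisc chart `E₁ = E₀[1/g_{D,λ}(Z_E)]` (smooth over `m°`, `σE₁`, `rE₁`,
  `comap_rE₁`) and the bridge map `Λ₀ : D₀ →ₐ[A″_j] E₁` (`EtalePair.lift` at `Z_{E,1}`) — PROVED.

All statements are [folklore]; no named facts.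

## Sources

* M. Temkin, arXiv:0804.1554v3, proof of Lemma 3.3.2 (pp. 45–46).
-/

noncomputable section

open Polynomial

namespace Literature.AlgebraicGeometry.Resolution

universe u

variable {k K m : Type u} [Field k] [Field K] [Algebra k K] [Field m] [Algebra k m]

/-! ## The `K`-side ring homomorphism `λ₀ : A″_j → E₀` -/

namespace DecompChart

variable {V : ValuationSubring k} {O : ValuationSubring m} {A : Subring K}
  {φ : Algebra.adjoin k (A : Set K) →ₐ[k] m} (C : DecompChart V O A φ)

/-! ### The distinguished elements of `Rh` -/

/-- `s ∈ Rh`. [folklore] -/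
def sR : C.Rh := ⟨C.s, C.s_mem_Rh⟩

/-- `h ∈ Rh`. [folklore] -/
def hR : C.Rh := ⟨C.h, C.R_le_Rh C.hhR⟩

/-- `s(x) = 1`. [folklore] -/
@[simp] theorem φh_sR : C.φh C.sR = 1 := by
  rw [sR, ← C.ev_of_mem C.s_mem_Rh]; exact C.ev_s

/-- `h(x) = 1`. [folklore] -/
@[simp] theorem φh_hR : C.φh C.hR = 1 := by
  rw [hR, C.hφhφ ⟨C.h, C.hhR⟩]; exact C.hφh

/-- The unit `t = a_y r_a / π^{N_a}` as an element of `K` (independent of `j`). [folklore] -/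
def tK : K := C.ay * C.ra / C.πK ^ C.Na

/-- `t_j = tK` for every admissible `j`. [folklore] -/
theorem t_eq_tK {j : ℕ} (hj : C.jH ≤ j) : C.t hj = C.tK := by
  rw [tK, C.ay_mul_ra hj, mul_div_cancel_left₀ _ (pow_ne_zero _ C.πK_ne_zero)]

/-- `tK ∈ Rh`. [folklore] -/
theorem tK_mem_Rh : C.tK ∈ C.Rh := by
  rw [tK, div_eq_mul_inv, ← inv_pow, πK, ← map_inv₀, ← map_pow]
  exact C.Rh.mul_mem (C.Rh.mul_mem (C.A₀_subset_Rh C.ay_mem_A₀) (C.A₀_subset_Rh C.ra_mem_A₀))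
    (Subalgebra.algebraMap_mem _ _)

/-- `t ∈ Rh`. [folklore] -/
def tR : C.Rh := ⟨C.tK, C.tK_mem_Rh⟩

/-- `t(x) ∈ m°`. [folklore] -/
theorem φh_tR_mem : C.φh C.tR ∈ O := by
  rw [tR, ← C.ev_of_mem C.tK_mem_Rh, ← C.t_eq_tK le_rfl]; exact C.ev_t_mem_O le_rfl

/-- `t(x)` is a unit of `m°`. [folklore] -/
theorem isUnit_φh_tR : IsUnit (⟨C.φh C.tR, C.φh_tR_mem⟩ : O) := by
  have h := C.isUnit_ev_t le_rfl
  have heq : ev φ (C.t le_rfl) = C.φh C.tR := by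
    rw [tR, ← C.ev_of_mem C.tK_mem_Rh, ← C.t_eq_tK le_rfl]
  rwa [show (⟨ev φ (C.t le_rfl), C.ev_t_mem_O le_rfl⟩ : O) = ⟨C.φh C.tR, C.φh_tR_mem⟩ from
    Subtype.ext heq] at h

/-- `y ∈ Rh`. [folklore] -/
def yR : C.Rh := ⟨C.y, C.A₀_subset_Rh C.y_mem_A₀⟩

/-- `a_y ∈ Rh`. [folklore] -/
def ayR : C.Rh := ⟨C.ay, C.A₀_subset_Rh C.ay_mem_A₀⟩

/-- `r_a ∈ Rh`. [folklore] -/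
def raR : C.Rh := ⟨C.ra, C.A₀_subset_Rh C.ra_mem_A₀⟩

/-- `y(x) = y₀`. [folklore] -/
@[simp] theorem φh_yR : C.φh C.yR = C.y₀ := by
  rw [yR, ← C.ev_of_mem (C.A₀_subset_Rh C.y_mem_A₀)]; rfl

/-- `y₀ ∈ m°`. [folklore] -/
theorem y₀_mem : C.y₀ ∈ O := mem_of_isIntegral_map V O C.hOV C.y₀_isIntegral

/-- Values of elements of `A₀` lie in `m°`. [folklore] -/
theorem φh_mem_O_of_mem_A₀ {z : K} (hz : z ∈ C.A₀) : C.φh ⟨z, C.A₀_subset_Rh hz⟩ ∈ O := by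
  rw [← C.ev_of_mem (C.A₀_subset_Rh hz)]; exact C.ev_mem_O_of_mem_A (C.A₀_le_A hz)

/-- `a_y · r_a = π^{N_a} t` in `Rh`. [folklore] -/
theorem ayR_mul_raR : C.ayR * C.raR = algebraMap k C.Rh (C.π ^ C.Na) * C.tR := by
  apply Subtype.ext
  change C.ay * C.ra = algebraMap k K (C.π ^ C.Na) * C.tK
  rw [C.ay_mul_ra le_rfl, C.t_eq_tK le_rfl, map_pow]; rfl

/-! ### Hypotheses tying a polydisc chart to the Hensel chart at level `j` -/

/-- The hypotheses under which the polydisc chart `ε` and the Hensel chart at level `j` (with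
Hensel exponent `e`) are bridged: `j = j_z + c`, the built-in units contain `s, h, t`, the Newton
zoom `r` dominates the `b`-exponents of the generators `f` and of `y, a_y, r_a`, and the
smallness exponent `M` dominates `e + N_a`. [folklore] -/
structure EHyps (ε : C.EParams) (e j : ℕ) : Prop where
  hj : C.jH ≤ j
  hje : C.bp + e + 2 * C.Na ≤ j
  hjc : ε.jz + C.c = j
  hsU : C.sR ∈ ε.U
  hhU : C.hR ∈ ε.U
  htU : C.tR ∈ ε.U
  hfr : ∀ z (hz : z ∈ C.f), C.repb ⟨z, C.A₀_subset_Rh (C.f_subset_A₀ hz)⟩ ≤ ε.r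
  hyr : C.repb C.yR ≤ ε.r
  hayr : C.repb C.ayR ≤ ε.r
  hrar : C.repb C.raR ≤ ε.r
  hM : e + C.Na ≤ ε.M

variable (ε : C.EParams) {e j : ℕ}

/-- `j₀ ≤ j`. [folklore] -/
theorem EHyps.hj₀ (H : C.EHyps ε e j) : C.j₀ ≤ j := le_trans C.j₀_le_jH H.hj

/-! ### The subring of `K` of elements with honest preimages in `E₀` -/

/-- The elements of `Rh` whose `ψ_E`-image lies in `E₀`. [folklore] -/
def preimE : Subring K where
  carrier := {z | ∃ hz : z ∈ C.Rh, ∃ x : C.E₀ ε, C.ιE ε x = C.ψE ε ⟨z, hz⟩}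
  mul_mem' := by
    rintro a b ⟨ha, x, hx⟩ ⟨hb, y, hy⟩
    exact ⟨C.Rh.mul_mem ha hb, x * y, by rw [map_mul, hx, hy, ← map_mul]; rfl⟩
  one_mem' := ⟨C.Rh.one_mem, 1, by rw [map_one, ← map_one (C.ψE ε)]; rfl⟩
  add_mem' := by
    rintro a b ⟨ha, x, hx⟩ ⟨hb, y, hy⟩
    exact ⟨C.Rh.add_mem ha hb, x + y, by rw [map_add, hx, hy, ← map_add]; rfl⟩
  zero_mem' := ⟨C.Rh.zero_mem, 0, by rw [map_zero, ← map_zero (C.ψE ε)]; rfl⟩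
  neg_mem' := by
    rintro a ⟨ha, x, hx⟩
    exact ⟨C.Rh.neg_mem ha, -x, by rw [map_neg, hx, ← map_neg]; rfl⟩

/-- Membership in `preimE` from an honest preimage. [folklore] -/
theorem mem_preimE {z : C.Rh} {x : C.E₀ ε} (hx : C.ιE ε x = C.ψE ε z) : (z : K) ∈ C.preimE ε :=
  ⟨z.2, x, by rw [hx]⟩

/-- Constants from `k°` have honest preimages. [folklore] -/
theorem algebraMap_mem_preimE {c : k} (hc : c ∈ V) : algebraMap k K c ∈ C.preimE ε := by
  refine C.mem_preimE ε (z := algebraMap k C.Rh c) (x := algebraMap O (C.E₀ ε) (C.vO ⟨c, hc⟩)) ?_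
  rw [ψE_algebraMap_k, ← C.ιm_coe ε]; rfl

/-- `k°_K ⊆ preimE`. [folklore] -/
theorem baseRing_le_preimE : baseRing K V ≤ C.preimE ε := by
  rintro _ ⟨c, hc, rfl⟩; exact C.algebraMap_mem_preimE ε hc

/-- The generators `f` have honest preimages (`b_f ≤ r`). [folklore] -/
theorem f_subset_preimE (H : C.EHyps ε e j) : (↑C.f : Set K) ⊆ C.preimE ε := fun z hz =>
  C.mem_preimE ε (z := ⟨z, C.A₀_subset_Rh (C.f_subset_A₀ hz)⟩)
    (C.ιE_zE ε _ (C.φh_mem_O_of_mem_A₀ (C.f_subset_A₀ hz)) (H.hfr z hz))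

/-- `A₀ ≤ preimE`. [folklore] -/
theorem A₀_le_preimE (H : C.EHyps ε e j) : C.A₀ ≤ C.preimE ε :=
  Subring.closure_le.mpr (Set.union_subset (C.baseRing_le_preimE ε) (C.f_subset_preimE ε H))

/-- `h` has an honest (unit) preimage. [folklore] -/
theorem ιE_zE_hR (H : C.EHyps ε e j) : C.ιE ε (C.zE ε C.hR (ε.hUO _ H.hhU)) = C.ψE ε C.hR :=
  C.ιE_zE ε _ _ (ε.hUr _ H.hhU)

/-- The polydisc coordinate `u′ᵢ ∈ E₀`. [folklore] -/
def uE (i : Fin C.n) : C.E₀ ε := algebraMap (MvPolynomial (Fin C.n) O) (C.E₀ ε) (MvPolynomial.X i)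

/-- `σ_E(u′ᵢ) = 0`. [folklore] -/
@[simp] theorem σE_uE (i : Fin C.n) : C.σE ε (C.uE ε i) = 0 := by
  rw [uE, σE_algebraMap, MvPolynomial.constantCoeff_X]

/-- `uᵢ ∈ Rh`. [folklore] -/
def uR (i : Fin C.n) : C.Rh := ⟨C.u j i, C.R_le_Rh (C.u_mem_R j i)⟩

/-- **`ψ_E(uᵢ) = ι_E(h_E^L · u′ᵢ)`** — the zoomed coordinates match (`j = j_z + c`). [folklore] -/
theorem ψE_uR (H : C.EHyps ε e j) (i : Fin C.n) :
    C.ψE ε (C.uR (j := j) i) = C.ιE ε (C.zE ε C.hR (ε.hUO _ H.hhU) ^ C.L * C.uE ε i) := by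
  -- `π^j · uᵢ = τᵢ = π^c h^L Tᵢ` in `Rh`
  have key : algebraMap k C.Rh (C.π ^ j) * C.uR (j := j) i =
      algebraMap k C.Rh (C.π ^ C.c) * (C.hR ^ C.L * C.Tsub i) := by
    apply Subtype.ext
    change algebraMap k K (C.π ^ j) * C.u j i = algebraMap k K (C.π ^ C.c) * (C.h ^ C.L * C.T i)
    rw [map_pow, map_pow, ← πK, ← C.τ_eq_pow_mul_u j i, τ]
  have h1 := congrArg (C.ψE ε) key
  simp only [map_mul, map_pow, ψE_algebraMap_k, C.ψE_Tsub] at h1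
  rw [← C.ιE_zE_hR ε H] at h1
  have hπj : C.ιm ε (algebraMap k m C.π) ^ j =
      C.ιm ε (algebraMap k m C.π) ^ ε.jz * C.ιm ε (algebraMap k m C.π) ^ C.c := by
    rw [← pow_add, H.hjc]
  rw [hπj] at h1
  rw [map_mul, map_pow, uE]
  -- cancel `π^{j_z} π^c`
  have hu : IsUnit (C.ιm ε (algebraMap k m C.π) ^ ε.jz * C.ιm ε (algebraMap k m C.π) ^ C.c) :=
    IsUnit.mul ((C.isUnit_ιm ε ((_root_.map_ne_zero _).mpr C.hπ0)).pow _)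
      ((C.isUnit_ιm ε ((_root_.map_ne_zero _).mpr C.hπ0)).pow _)
  refine hu.mul_left_cancel ?_
  rw [h1, ← C.ιm_coe' ε, coe_πO]
  ring

/-- `uᵢ ∈ preimE`. [folklore] -/
theorem u_mem_preimE (H : C.EHyps ε e j) (i : Fin C.n) : C.u j i ∈ C.preimE ε :=
  C.mem_preimE ε (z := C.uR i) (C.ψE_uR ε H i).symm

/-- `C_j ≤ preimE`. [folklore] -/
theorem Cj_le_preimE (H : C.EHyps ε e j) : C.Cj j ≤ C.preimE ε :=
  Subring.closure_le.mpr (Set.union_subset (C.A₀_le_preimE ε H)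
    (by rintro _ ⟨i, rfl⟩; exact C.u_mem_preimE ε H i))

/-! ### The preimage map and its ring homomorphisms -/

/-- The honest preimage `lamK z ∈ E₀` of `ψ_E(z)` (junk `0` off `preimE`). [folklore] -/
def lamK (z : K) : C.E₀ ε := by
  classical
  exact if h : z ∈ C.preimE ε then h.2.choose else 0

/-- `ι_E(lamK z) = ψ_E(z)` on `preimE`. [folklore] -/
theorem ιE_lamK {z : K} (h : z ∈ C.preimE ε) : C.ιE ε (C.lamK ε z) = C.ψE ε ⟨z, h.1⟩ := by
  classical
  rw [lamK, dif_pos h]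
  exact h.2.choose_spec

/-- `lamK` is determined by any honest preimage. [folklore] -/
theorem lamK_eq {z : C.Rh} {x : C.E₀ ε} (hx : C.ιE ε x = C.ψE ε z) : C.lamK ε z = x :=
  C.ιE_injective ε (by rw [C.ιE_lamK ε (C.mem_preimE ε hx), hx])

/-- The preimage map on a subring of `preimE` is a ring homomorphism. [folklore] -/
def lamSub (S : Subring K) (hS : S ≤ C.preimE ε) : S →+* C.E₀ ε where
  toFun z := C.lamK ε z
  map_one' := C.lamK_eq ε (z := 1) (x := 1) (by rw [map_one, map_one])
  map_mul' a b := by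
    apply C.ιE_injective ε
    rw [map_mul, C.ιE_lamK ε (hS a.2), C.ιE_lamK ε (hS b.2), Subring.coe_mul,
      C.ιE_lamK ε (hS (S.mul_mem a.2 b.2)), ← map_mul]; rfl
  map_zero' := C.lamK_eq ε (z := 0) (x := 0) (by rw [map_zero, map_zero])
  map_add' a b := by
    apply C.ιE_injective ε
    rw [map_add, C.ιE_lamK ε (hS a.2), C.ιE_lamK ε (hS b.2), Subring.coe_add,
      C.ιE_lamK ε (hS (S.add_mem a.2 b.2)), ← map_add]; rfl

/-- `ι_E ∘ lamSub = ψ_E`. [folklore] -/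
theorem ιE_lamSub (S : Subring K) (hS : S ≤ C.preimE ε) (z : S) :
    C.ιE ε (C.lamSub ε S hS z) = C.ψE ε ⟨z, (hS z.2).1⟩ := C.ιE_lamK ε (hS z.2)

/-- **Normality step**: `A′_j = Nr_K(C_j) ≤ preimE` — `E₀` is smooth over the normal domain `m°`,
hence integrally closed in `Ω_E`. [folklore] -/
theorem Aj_le_preimE (H : C.EHyps ε e j) : C.Aj j ≤ C.preimE ε := by
  intro z hz
  have hzRh : z ∈ C.Rh := C.R_le_Rh (C.Aj_le_R j hz)
  set lam := C.lamSub ε (C.Cj j) (C.Cj_le_preimE ε H) with hlam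
  -- `ψE z` is integral over `E₀`
  -- the inclusion `C_j → Rh`
  let incl : C.Cj j →+* C.Rh :=
    { toFun := fun c => ⟨c, C.R_le_Rh (C.Aj_le_R j (C.Cj_le_Aj j c.2))⟩
      map_one' := rfl, map_mul' := fun _ _ => rfl, map_zero' := rfl, map_add' := fun _ _ => rfl }
  have hint : IsIntegral (C.E₀ ε) (C.ψE ε ⟨z, hzRh⟩) := by
    obtain ⟨q, hqm, hq0⟩ := (C.mem_Aj_iff j z).mp hz
    refine ⟨q.map lam, hqm.map _, ?_⟩
    have hcomp : (algebraMap (C.E₀ ε) (C.ΩE ε)).comp lam = (C.ψE ε : C.Rh →+* C.ΩE ε).comp incl := by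
      ext c
      rw [RingHom.comp_apply, RingHom.comp_apply, Algebra.TensorProduct.algebraMap_apply,
        Algebra.algebraMap_self, RingHom.id_apply]
      exact C.ιE_lamSub ε _ _ c
    have hev : Polynomial.eval₂ incl ⟨z, hzRh⟩ q = 0 := by
      apply Subtype.ext
      have h2 := Polynomial.hom_eval₂ q incl (C.Rh.val : C.Rh →+* K) ⟨z, hzRh⟩
      rw [show (C.Rh.val : C.Rh →+* K).comp incl = algebraMap (C.Cj j) K from RingHom.ext fun _ => rfl]
        at h2
      exact h2.trans hq0
    rw [Polynomial.eval₂_map, hcomp, show (C.ψE ε) ⟨z, hzRh⟩ = (C.ψE ε : C.Rh →+* C.ΩE ε) ⟨z, hzRh⟩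
      from rfl, ← Polynomial.hom_eval₂, hev, map_zero]
  obtain ⟨x, hx⟩ := mem_range_of_isIntegral_tensor_fractionRing (P := O) (S := C.E₀ ε) (Q := m)
    (C.ψE ε ⟨z, hzRh⟩) hint
  exact ⟨hzRh, x, hx⟩

/-! ### `λ` on `A′_j`, `A″₀_j`, `A″_j` -/

section Lam

variable (H : C.EHyps ε e j)

/-- `λ` on `A′_j`. [folklore] -/
def lamAj : C.Aj j →+* C.E₀ ε := C.lamSub ε (C.Aj j) (C.Aj_le_preimE ε H)

/-- `ι_E(λ z) = ψ_E(z)` on `A′_j`. [folklore] -/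
theorem ιE_lamAj (z : C.Aj j) :
    C.ιE ε (C.lamAj ε H z) = C.ψE ε ⟨z, C.R_le_Rh (C.Aj_le_R j z.2)⟩ :=
  C.ιE_lamSub ε _ _ z

/-- `d ∈ A′_j`. [folklore] -/
def dAj : C.Aj j := ⟨C.d, C.d_mem_Aj H.hj₀⟩

/-- `d ∈ Rh`. [folklore] -/
def dR : C.Rh := ⟨C.d, C.d_mem_Rh⟩

/-- `d = s (s h)` in `Rh`. [folklore] -/
theorem dR_eq : C.dR = C.sR * (C.sR * C.hR) := rfl

/-- The honest unit preimage of `d`. [folklore] -/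
def dE : C.E₀ ε := C.zE ε C.sR (ε.hUO _ H.hsU) * (C.zE ε C.sR (ε.hUO _ H.hsU) * C.zE ε C.hR (ε.hUO _ H.hhU))

/-- `ι_E(d_E) = ψ_E(d)`. [folklore] -/
theorem ιE_dE : C.ιE ε (C.dE ε H) = C.ψE ε C.dR := by
  rw [dE, map_mul, map_mul, C.ιE_zE ε _ _ (ε.hUr _ H.hsU), C.ιE_zE ε _ _ (ε.hUr _ H.hhU), dR_eq,
    map_mul, map_mul]

/-- `d_E` is a unit. [folklore] -/
theorem isUnit_dE : IsUnit (C.dE ε H) :=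
  IsUnit.mul (C.isUnit_zE ε H.hsU) (IsUnit.mul (C.isUnit_zE ε H.hsU) (C.isUnit_zE ε H.hhU))

/-- `λ(d) = d_E`. [folklore] -/
theorem lamAj_dAj : C.lamAj ε H (C.dAj ε H) = C.dE ε H :=
  C.lamK_eq ε (z := C.dR) (C.ιE_dE ε H)

/-- `λ` on `A″₀_j = A′_j[1/d]`. [folklore] -/
def lamA₀ : C.A''₀ H.hj₀ →+* C.E₀ ε :=
  letI : Algebra (C.Aj j) (C.A''₀ H.hj₀) := algebra_awaySubring (C.Aj j) C.d (C.d_mem_Aj H.hj₀)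
  haveI : IsLocalization.Away (C.dAj ε H) (C.A''₀ H.hj₀) :=
    isLocalization_awaySubring (C.Aj j) (C.d_mem_Aj H.hj₀) C.d_ne_zero
  IsLocalization.Away.lift (C.dAj ε H) (g := C.lamAj ε H) (by rw [C.lamAj_dAj]; exact C.isUnit_dE ε H)

/-- `λ` on `A″₀_j` extends `λ` on `A′_j`. [folklore] -/
theorem lamA₀_of_mem_Aj {z : K} (hz : z ∈ C.Aj j) :
    C.lamA₀ ε H ⟨z, C.Aj_le_A''₀ H.hj₀ hz⟩ = C.lamAj ε H ⟨z, hz⟩ := by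
  letI : Algebra (C.Aj j) (C.A''₀ H.hj₀) := algebra_awaySubring (C.Aj j) C.d (C.d_mem_Aj H.hj₀)
  haveI : IsLocalization.Away (C.dAj ε H) (C.A''₀ H.hj₀) :=
    isLocalization_awaySubring (C.Aj j) (C.d_mem_Aj H.hj₀) C.d_ne_zero
  exact IsLocalization.Away.lift_eq (C.dAj ε H) _ ⟨z, hz⟩

include H in
/-- `ψ_E(d)` is a unit of `Ω_E`. [folklore] -/
theorem isUnit_ψE_dR : IsUnit (C.ψE ε C.dR) := by
  rw [← C.ιE_dE ε H]; exact (C.isUnit_dE ε H).map _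

/-- **`ι_E ∘ λ = ψ_E` on `A″₀_j ∩ Rh`.** [folklore] -/
theorem ιE_lamA₀ {z : K} (hz : z ∈ C.A''₀ H.hj₀) (hzR : z ∈ C.Rh) :
    C.ιE ε (C.lamA₀ ε H ⟨z, hz⟩) = C.ψE ε ⟨z, hzR⟩ := by
  obtain ⟨N, hN⟩ := (C.mem_A''₀_iff H.hj₀ z).mp hz
  -- `λ(d)^N λ(z) = λ(d^N z)` and `d^N z ∈ A′_j`
  have hprod : (⟨C.d ^ N * z, C.Aj_le_A''₀ H.hj₀ hN⟩ : C.A''₀ H.hj₀) =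
      ⟨C.d, C.Aj_le_A''₀ H.hj₀ (C.d_mem_Aj H.hj₀)⟩ ^ N * ⟨z, hz⟩ := rfl
  have h1 := C.lamA₀_of_mem_Aj ε H hN
  rw [hprod, map_mul, map_pow, C.lamA₀_of_mem_Aj ε H (C.d_mem_Aj H.hj₀)] at h1
  have h2 := congrArg (C.ιE ε) h1
  rw [map_mul, map_pow, show (⟨C.d, C.d_mem_Aj H.hj₀⟩ : C.Aj j) = C.dAj ε H from rfl, C.lamAj_dAj,
    C.ιE_dE ε H, C.ιE_lamAj] at h2
  have h3 : (⟨C.d ^ N * z, C.R_le_Rh (C.Aj_le_R j hN)⟩ : C.Rh) = C.dR ^ N * ⟨z, hzR⟩ := rfl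
  rw [h3, map_mul, map_pow] at h2
  exact ((C.isUnit_ψE_dR ε H).pow N).mul_left_cancel h2

/-- `t ∈ A″₀_j`. [folklore] -/
def tA₀ : C.A''₀ H.hj₀ := ⟨C.t H.hj, C.t_mem_A''₀ H.hj⟩

/-- `λ(t) = t_E`, the honest unit preimage. [folklore] -/
theorem lamA₀_tA₀ : C.lamA₀ ε H (C.tA₀ ε H) = C.zE ε C.tR (ε.hUO _ H.htU) := by
  apply C.ιE_injective ε
  rw [tA₀, C.ιE_zE ε _ _ (ε.hUr _ H.htU)]
  have htR : C.t H.hj ∈ C.Rh := by rw [C.t_eq_tK H.hj]; exact C.tK_mem_Rh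
  rw [C.ιE_lamA₀ ε H (C.t_mem_A''₀ H.hj) htR]
  congr 1
  exact Subtype.ext (C.t_eq_tK H.hj)

/-- **`λ₀ : A″_j → E₀`** — the `K`-side of the bridge. [folklore] -/
def lam₀ : C.A'' H.hj →+* C.E₀ ε :=
  letI : Algebra (C.A''₀ H.hj₀) (C.A'' H.hj) :=
    algebra_awaySubring (C.A''₀ H.hj₀) (C.t H.hj) (C.t_mem_A''₀ H.hj)
  haveI : IsLocalization.Away (C.tA₀ ε H) (C.A'' H.hj) :=
    isLocalization_awaySubring (C.A''₀ H.hj₀) (C.t_mem_A''₀ H.hj) (C.t_ne_zero H.hj)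
  IsLocalization.Away.lift (C.tA₀ ε H) (g := C.lamA₀ ε H)
    (by rw [C.lamA₀_tA₀]; exact C.isUnit_zE ε H.htU)

/-- `λ₀` extends `λ` on `A″₀_j`. [folklore] -/
theorem lam₀_of_mem_A''₀ {z : K} (hz : z ∈ C.A''₀ H.hj₀) :
    C.lam₀ ε H ⟨z, C.A''₀_le_A'' H.hj hz⟩ = C.lamA₀ ε H ⟨z, hz⟩ := by
  letI : Algebra (C.A''₀ H.hj₀) (C.A'' H.hj) :=
    algebra_awaySubring (C.A''₀ H.hj₀) (C.t H.hj) (C.t_mem_A''₀ H.hj)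
  haveI : IsLocalization.Away (C.tA₀ ε H) (C.A'' H.hj) :=
    isLocalization_awaySubring (C.A''₀ H.hj₀) (C.t_mem_A''₀ H.hj) (C.t_ne_zero H.hj)
  exact IsLocalization.Away.lift_eq (C.tA₀ ε H) _ ⟨z, hz⟩

/-- `λ₀` extends `λ` on `A′_j`. [folklore] -/
theorem lam₀_of_mem_Aj {z : K} (hz : z ∈ C.Aj j) :
    C.lam₀ ε H ⟨z, C.A''₀_le_A'' H.hj (C.Aj_le_A''₀ H.hj₀ hz)⟩ = C.lamAj ε H ⟨z, hz⟩ := by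
  rw [C.lam₀_of_mem_A''₀ ε H (C.Aj_le_A''₀ H.hj₀ hz), C.lamA₀_of_mem_Aj ε H hz]

include H in
/-- `ψ_E(t)` is a unit of `Ω_E`. [folklore] -/
theorem isUnit_ψE_tR : IsUnit (C.ψE ε C.tR) := by
  rw [← C.ιE_zE ε _ _ (ε.hUr _ H.htU)]; exact (C.isUnit_zE ε H.htU).map _

/-- **`ι_E ∘ λ₀ = ψ_E` on `A″_j ∩ Rh`.** [folklore] -/
theorem ιE_lam₀ {z : K} (hz : z ∈ C.A'' H.hj) (hzR : z ∈ C.Rh) :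
    C.ιE ε (C.lam₀ ε H ⟨z, hz⟩) = C.ψE ε ⟨z, hzR⟩ := by
  obtain ⟨N, hN⟩ := mem_awaySubring_iff.mp hz
  have htR : C.t H.hj ∈ C.Rh := by rw [C.t_eq_tK H.hj]; exact C.tK_mem_Rh
  have hprod : (⟨C.t H.hj ^ N * z, C.A''₀_le_A'' H.hj hN⟩ : C.A'' H.hj) =
      ⟨C.t H.hj, C.A''₀_le_A'' H.hj (C.t_mem_A''₀ H.hj)⟩ ^ N * ⟨z, hz⟩ := rfl
  have h1 := C.lam₀_of_mem_A''₀ ε H hN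
  rw [hprod, map_mul, map_pow, C.lam₀_of_mem_A''₀ ε H (C.t_mem_A''₀ H.hj),
    show (⟨C.t H.hj, C.t_mem_A''₀ H.hj⟩ : C.A''₀ H.hj₀) = C.tA₀ ε H from rfl, C.lamA₀_tA₀] at h1
  have h2 := congrArg (C.ιE ε) h1
  rw [map_mul, map_pow, C.ιE_zE ε _ _ (ε.hUr _ H.htU),
    C.ιE_lamA₀ ε H hN (C.Rh.mul_mem (C.Rh.pow_mem htR N) hzR)] at h2
  have h3 : (⟨C.t H.hj ^ N * z, C.Rh.mul_mem (C.Rh.pow_mem htR N) hzR⟩ : C.Rh) = C.tR ^ N * ⟨z, hzR⟩ :=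
    Subtype.ext (by change C.t H.hj ^ N * z = C.tK ^ N * z; rw [C.t_eq_tK H.hj])
  rw [h3, map_mul, map_pow] at h2
  exact ((C.isUnit_ψE_tR ε H).pow N).mul_left_cancel h2

/-- `λ₀` on elements of `A₀`: the honest preimages. [folklore] -/
theorem lam₀_of_mem_A₀ {z : K} (hzA : z ∈ C.A₀) {x : C.E₀ ε}
    (hx : C.ιE ε x = C.ψE ε ⟨z, C.A₀_subset_Rh hzA⟩) :
    C.lam₀ ε H ⟨z, C.A₀_subset_A'' H.hj hzA⟩ = x :=
  C.ιE_injective ε (by rw [C.ιE_lam₀ ε H _ (C.A₀_subset_Rh hzA), hx])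

/-! ### Values of `λ₀` on the Hensel data -/

/-- `y_E`. [folklore] -/
def yE : C.E₀ ε := C.zE ε C.yR (by rw [φh_yR]; exact C.y₀_mem)

/-- `a_{y,E}`. [folklore] -/
def ayE : C.E₀ ε := C.zE ε C.ayR (C.φh_mem_O_of_mem_A₀ C.ay_mem_A₀)

/-- `r_{a,E}`. [folklore] -/
def raE : C.E₀ ε := C.zE ε C.raR (C.φh_mem_O_of_mem_A₀ C.ra_mem_A₀)

/-- `t_E` (a unit). [folklore] -/
def tEu : (C.E₀ ε)ˣ := (C.isUnit_zE ε H.htU).unit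

/-- `λ₀(π) = π`. [folklore] -/
theorem lam₀_πS : C.lam₀ ε H (C.πS H.hj) = algebraMap O (C.E₀ ε) C.πO := by
  refine C.lam₀_of_mem_A₀ ε H C.πK_mem_A₀ ?_
  rw [← C.ιm_coe ε, coe_πO, ← ψE_algebraMap_k]; rfl

/-- `λ₀(y) = y_E`. [folklore] -/
theorem lam₀_yS : C.lam₀ ε H (C.yS H.hj) = C.yE ε :=
  C.lam₀_of_mem_A₀ ε H C.y_mem_A₀ (C.ιE_zE ε _ _ H.hyr)

/-- `λ₀(δ) = π^e a_{y,E}`. [folklore] -/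
theorem lam₀_δS : C.lam₀ ε H (C.δS e H.hj) = algebraMap O (C.E₀ ε) C.πO ^ e * C.ayE ε := by
  refine C.lam₀_of_mem_A₀ ε H (Subring.mul_mem _ (Subring.pow_mem _ C.πK_mem_A₀ _) C.ay_mem_A₀) ?_
  rw [map_mul, map_pow, ayE, C.ιE_zE ε _ _ H.hayr, ← C.ιm_coe ε, coe_πO, ← ψE_algebraMap_k,
    ← map_pow, ← map_pow, ← map_mul]
  congr 1
  apply Subtype.ext
  change algebraMap k K (C.π ^ e) * C.ay = C.πK ^ e * C.ay
  rw [map_pow]; rfl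

/-- `λ₀(ι) · t_E = r_{a,E}` (from `ι t = r_a`). [folklore] -/
theorem lam₀_ιS_mul : C.lam₀ ε H (C.ιS H.hj) * (C.tEu ε H : C.E₀ ε) = C.raE ε := by
  have hιt : C.ιS H.hj * ⟨C.t H.hj, C.A''₀_le_A'' H.hj (C.t_mem_A''₀ H.hj)⟩ =
      (⟨C.ra, C.A₀_subset_A'' H.hj C.ra_mem_A₀⟩ : C.A'' H.hj) := by
    apply Subtype.ext
    change C.ι H.hj * C.t H.hj = C.ra
    rw [ι, inv_mul_cancel_right₀ (C.t_ne_zero H.hj)]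
  have h1 := congrArg (C.lam₀ ε H) hιt
  rw [map_mul, C.lam₀_of_mem_A''₀ ε H (C.t_mem_A''₀ H.hj),
    show (⟨C.t H.hj, C.t_mem_A''₀ H.hj⟩ : C.A''₀ H.hj₀) = C.tA₀ ε H from rfl, C.lamA₀_tA₀,
    C.lam₀_of_mem_A₀ ε H C.ra_mem_A₀ (C.ιE_zE ε _ _ H.hrar)] at h1
  exact h1

/-- The image `ι_λ = λ₀(ι) = r_{a,E} t_E⁻¹`. [folklore] -/
theorem lam₀_ιS : C.lam₀ ε H (C.ιS H.hj) = C.raE ε * ↑((C.tEu ε H)⁻¹) := by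
  rw [← C.lam₀_ιS_mul ε H, mul_assoc, Units.mul_inv, mul_one]

end Lam

/-! ### The root `Z_E` of `p_new` in the polydisc chart -/

section Root

variable (H : C.EHyps ε e j)

/-- `y₀ ∈ m°` as an element. [folklore] -/
def y₀O : O := ⟨C.y₀, C.y₀_mem⟩

/-- `σ_E(y_E) = y₀`. [folklore] -/
theorem σE_yE : C.σE ε (C.yE ε) = C.y₀O := by
  rw [yE, C.σE_zE]; exact Subtype.ext C.φh_yR

/-- Powers of `π` are non-zero-divisors of `E₀` (flat over the domain `m°`). [folklore] -/
theorem πE_cancel {n : ℕ} {a b : C.E₀ ε}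
    (h : algebraMap O (C.E₀ ε) (C.πO ^ n) * a = algebraMap O (C.E₀ ε) (C.πO ^ n) * b) : a = b := by
  have hreg : IsSMulRegular (C.E₀ ε) (algebraMap O (C.E₀ ε) (C.πO ^ n)) :=
    IsSMulRegular.of_flat (isLeftRegular_iff.mp (IsRegular.of_ne_zero (pow_ne_zero n C.πO_ne_zero)).left)
  exact hreg h

/-- The image `ι_λ = r_{a,E} t_E⁻¹` of `ι`. [folklore] -/
def ιlE : C.E₀ ε := C.raE ε * ↑((C.tEu ε H)⁻¹)

/-- **Existence of the Newton root datum**: `π^{e+N_a} Z = (y₀ − y_E) ι_λ` is solvable in `E₀`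
(`y_E ≡ y₀ mod π^M`, `M ≥ e + N_a`). [folklore] -/
theorem exists_ZE : ∃ Z : C.E₀ ε, algebraMap O (C.E₀ ε) (C.πO ^ (e + C.Na)) * Z =
    (algebraMap O (C.E₀ ε) C.y₀O - C.yE ε) * C.ιlE ε H := by
  obtain ⟨x, hx⟩ := C.zE_small ε C.yR (by rw [φh_yR]; exact C.y₀_mem) H.hyr
  obtain ⟨d, hd⟩ : ∃ d, ε.M = e + C.Na + d := ⟨ε.M - (e + C.Na), by have := H.hM; omega⟩
  refine ⟨-(algebraMap O (C.E₀ ε) (C.πO ^ d) * x * C.ιlE ε H), ?_⟩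
  have hy : (⟨C.φh C.yR, by rw [φh_yR]; exact C.y₀_mem⟩ : O) = C.y₀O := Subtype.ext C.φh_yR
  rw [yE, hx, hy, hd]
  simp only [pow_add, map_mul, map_pow]
  ring

/-- **The Newton root datum `Z_E ∈ E₀`.** [folklore] -/
def ZE : C.E₀ ε := (C.exists_ZE ε H).choose

/-- Defining identity of `Z_E`. [folklore] -/
theorem ZE_spec : algebraMap O (C.E₀ ε) (C.πO ^ (e + C.Na)) * C.ZE ε H =
    (algebraMap O (C.E₀ ε) C.y₀O - C.yE ε) * C.ιlE ε H := (C.exists_ZE ε H).choose_spec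

/-- `σ_E(Z_E) = 0`. [folklore] -/
theorem σE_ZE : C.σE ε (C.ZE ε H) = 0 := by
  have h := congrArg (C.σE ε) (C.ZE_spec ε H)
  rw [map_mul, map_mul, map_sub, σE_algebraMap_O, σE_algebraMap_O, C.σE_yE ε, sub_self,
    zero_mul] at h
  exact C.pow_πO_mul_eq_zero h

/-- **The Hensel root in the polydisc chart**: `ζ_E = y_E + π^e a_{y,E} Z_E`. [folklore] -/
def ζE : C.E₀ ε := C.yE ε + algebraMap O (C.E₀ ε) C.πO ^ e * C.ayE ε * C.ZE ε H

/-- **`ι_E(ζ_E) = y₀`**: the Hensel root of the polydisc chart is `y₀ ∈ m`. [folklore] -/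
theorem ιE_ζE : C.ιE ε (C.ζE ε H) = C.ιm ε C.y₀ := by
  have hyO : C.φh C.yR ∈ O := by rw [φh_yR]; exact C.y₀_mem
  -- the three identities in `Ω_E`
  have E1 := congrArg (C.ιE ε) (C.ZE_spec ε H)
  rw [map_mul, map_mul, map_sub, ← C.ιm_coe ε, ← C.ιm_coe ε, ιlE, map_mul, yE,
    C.ιE_zE ε _ _ H.hyr, raE, C.ιE_zE ε _ _ H.hrar] at E1
  simp only [SubmonoidClass.coe_pow, coe_πO, map_pow, y₀O] at E1
  have E2 : C.ιE ε ↑((C.tEu ε H)⁻¹) * C.ψE ε C.tR = 1 := by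
    rw [← C.ιE_zE ε _ (ε.hUO _ H.htU) (ε.hUr _ H.htU), ← map_mul,
      show C.zE ε C.tR (ε.hUO _ H.htU) = (C.tEu ε H : C.E₀ ε) from rfl, Units.inv_mul, map_one]
  have E3 := congrArg (C.ψE ε) C.ayR_mul_raR
  rw [map_mul, map_mul, ψE_algebraMap_k, map_pow, map_pow] at E3
  -- the goal
  rw [ζE, map_add, map_mul, map_mul, map_pow, yE, C.ιE_zE ε _ _ H.hyr, ayE, C.ιE_zE ε _ _ H.hayr,
    ← C.ιm_coe ε, coe_πO]
  have hu : IsUnit (C.ιm ε (algebraMap k m C.π) ^ C.Na * C.ψE ε C.tR) :=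
    IsUnit.mul ((C.isUnit_ιm ε ((_root_.map_ne_zero _).mpr C.hπ0)).pow _) (C.isUnit_ψE_tR ε H)
  rw [← sub_eq_zero]
  refine hu.mul_left_cancel ?_
  rw [mul_zero]
  linear_combination (C.ψE ε C.ayR * C.ψE ε C.tR) * E1 +
    (C.ιm ε C.y₀ - C.ψE ε C.yR) * C.ψE ε C.ayR * C.ψE ε C.raR * E2 +
    (C.ιm ε C.y₀ - C.ψE ε C.yR) * E3

/-- The coefficients of `p` over `A″_j` map to those of `p` over `k`. [folklore] -/
theorem map_pS_lam₀ : ((C.pS H.hj).map (C.lam₀ ε H)).map (algebraMap (C.E₀ ε) (C.ΩE ε)) =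
    C.p.map ((C.ιm ε : m →+* C.ΩE ε).comp (algebraMap k m)) := by
  rw [Polynomial.map_map]
  ext i
  rw [Polynomial.coeff_map, Polynomial.coeff_map, RingHom.comp_apply, RingHom.comp_apply]
  have hi : (((C.pS H.hj).coeff i : C.A'' H.hj) : K) = algebraMap k K (C.p.coeff i) := by
    have := congrArg (fun q => Polynomial.coeff q i) (C.map_pS H.hj)
    simp only [Polynomial.coeff_map, Subring.coe_subtype] at this
    rw [this, pK, Polynomial.coeff_map]
  have hRh : algebraMap k K (C.p.coeff i) ∈ C.Rh := Subalgebra.algebraMap_mem _ _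
  rw [Algebra.TensorProduct.algebraMap_apply, Algebra.algebraMap_self, RingHom.id_apply,
    show ((C.lam₀ ε H) ((C.pS H.hj).coeff i)) ⊗ₜ[O] (1 : m) = C.ιE ε (C.lam₀ ε H ((C.pS H.hj).coeff i))
      from rfl,
    show (C.pS H.hj).coeff i = ⟨_, ((C.pS H.hj).coeff i).2⟩ from rfl]
  rw [C.ιE_lam₀ ε H _ (by rw [hi]; exact hRh)]
  have : (⟨(((C.pS H.hj).coeff i : C.A'' H.hj) : K), by rw [hi]; exact hRh⟩ : C.Rh) =
      algebraMap k C.Rh (C.p.coeff i) := Subtype.ext hi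
  rw [this, ψE_algebraMap_k]; rfl

/-- **`ζ_E` is a root of `p`** (over `A″_j`, transported by `λ₀`). [folklore] -/
theorem aeval_ζE_pS : Polynomial.aeval (C.ζE ε H) ((C.pS H.hj).map (C.lam₀ ε H)) = 0 := by
  apply C.ιE_injective ε
  rw [map_zero, Polynomial.coe_aeval_eq_eval]
  change (algebraMap (C.E₀ ε) (C.ΩE ε))
    (Polynomial.eval₂ (RingHom.id _) (C.ζE ε H) ((C.pS H.hj).map (C.lam₀ ε H))) = 0
  rw [Polynomial.hom_eval₂, RingHom.comp_id, ← Polynomial.eval_map, C.map_pS_lam₀ ε H,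
    Polynomial.eval_map, show (algebraMap (C.E₀ ε) (C.ΩE ε)) (C.ζE ε H) = C.ιE ε (C.ζE ε H) from rfl,
    C.ιE_ζE ε H, show C.ιm ε C.y₀ = (C.ιm ε : m →+* C.ΩE ε) C.y₀ from rfl, ← Polynomial.hom_eval₂,
    ← Polynomial.aeval_def, C.aeval_y₀_p, map_zero]

/-- **`Z_E` is a root of `p_new`** (transported by `λ₀`). [folklore] -/
theorem aeval_ZE_pnewS : Polynomial.aeval (C.ZE ε H) ((C.pnewS e H.hj H.hje).map (C.lam₀ ε H)) = 0 := by
  have h := congrArg (fun q => Polynomial.aeval (C.ZE ε H) (Polynomial.map (C.lam₀ ε H) q))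
    (C.C_mul_pnewS e H.hj H.hje)
  simp only [Polynomial.map_mul, Polynomial.map_pow, Polynomial.map_C, Polynomial.map_comp,
    Polynomial.map_add, Polynomial.map_X, map_mul, map_pow, Polynomial.aeval_C, Polynomial.aeval_comp,
    map_add, Polynomial.aeval_X, Algebra.algebraMap_self, RingHom.id_apply] at h
  rw [C.lam₀_πS ε H, C.lam₀_yS ε H, C.lam₀_δS ε H, show C.yE ε + (algebraMap O (C.E₀ ε)) C.πO ^ e *
      C.ayE ε * C.ZE ε H = C.ζE ε H from rfl, C.aeval_ζE_pS ε H, mul_zero, ← map_pow] at h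
  exact C.πE_cancel ε (h.trans (mul_zero _).symm)

/-- The localized polynomial of the Hensel chart at `Z_E`:
`g_{D,λ} = (p_new′ · (p_new − p_new(0))/Z)^{λ₀}(Z_E)`. [folklore] -/
def gDlam : C.E₀ ε := Polynomial.aeval (C.ZE ε H) ((C.PD e H.hj H.hje).g.map (C.lam₀ ε H))

/-- **`σ_E(g_{D,λ}) = 1`** — inverting `g_{D,λ}` keeps the `m°`-point. [folklore] -/
theorem σE_gDlam : C.σE ε (C.gDlam ε H) = 1 := by
  rw [gDlam, Polynomial.coe_aeval_eq_eval,
    show Polynomial.eval (C.ZE ε H) (((C.PD e H.hj H.hje).g).map (C.lam₀ ε H)) =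
      Polynomial.eval₂ (RingHom.id _) (C.ZE ε H) (((C.PD e H.hj H.hje).g).map (C.lam₀ ε H)) from rfl,
    Polynomial.hom_eval₂, RingHom.comp_id, C.σE_ZE ε H, Polynomial.eval₂_at_zero,
    Polynomial.coeff_map]
  have h0 : ((C.PD e H.hj H.hje).g).coeff 0 = 1 := by
    change (derivative (C.pnewS e H.hj H.hje) * (C.pnewS e H.hj H.hje).divX).coeff 0 = 1
    rw [Polynomial.mul_coeff_zero, Polynomial.coeff_derivative, Polynomial.coeff_divX, zero_add,
      C.coeff_pnewS_one, Nat.cast_zero, zero_add, mul_one, mul_one]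
  rw [h0, map_one, map_one]

end Root

/-! ### The final polydisc chart `E₁ = E₀[1/g_{D,λ}]` and the bridge map `Λ₀ : D₀ → E₁` -/

section E1

variable (H : C.EHyps ε e j)

/-- **The final polydisc chart** `E₁ = E₀[1/g_{D,λ}]`. [folklore] -/
abbrev E₁ : Type u := Localization.Away (C.gDlam ε H)

/-- `E₁` is smooth over `E₀`. [folklore] -/
instance smooth_E₁_E₀ : Algebra.Smooth (C.E₀ ε) (C.E₁ ε H) :=
  Algebra.Smooth.of_isLocalization_Away (C.gDlam ε H)

/-- **`E₁` is smooth over `m°`.** [folklore] -/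
instance smooth_E₁ : Algebra.Smooth O (C.E₁ ε H) := Algebra.Smooth.comp O (C.E₀ ε) (C.E₁ ε H)

/-- The `m°`-point of `E₁`. [folklore] -/
def σE₁ : C.E₁ ε H →+* O :=
  IsLocalization.Away.lift (C.gDlam ε H) (g := C.σE ε) (by rw [C.σE_gDlam]; exact isUnit_one)

/-- `σ_{E,1}` extends `σ_E`. [folklore] -/
@[simp] theorem σE₁_algebraMap (x : C.E₀ ε) : C.σE₁ ε H (algebraMap (C.E₀ ε) (C.E₁ ε H) x) = C.σE ε x :=
  IsLocalization.Away.lift_eq _ _ x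

/-- `σ_{E,1}` on `m°` is the identity. [folklore] -/
@[simp] theorem σE₁_algebraMap_O (a : O) : C.σE₁ ε H (algebraMap O (C.E₁ ε H) a) = a := by
  rw [IsScalarTower.algebraMap_apply O (C.E₀ ε) (C.E₁ ε H), σE₁_algebraMap, σE_algebraMap_O]

/-- The point `r_{E,1}` of the final chart over the centre of `m°`. [folklore] -/
def rE₁ : Ideal (C.E₁ ε H) := (IsLocalRing.maximalIdeal O).comap (C.σE₁ ε H)

/-- `r_{E,1}` is prime. [folklore] -/
instance rE₁_isPrime : (C.rE₁ ε H).IsPrime := by unfold rE₁; exact Ideal.comap_isPrime _ _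

/-- `r_{E,1}` lies over the maximal ideal of `m°`. [folklore] -/
theorem comap_rE₁ : (C.rE₁ ε H).comap (algebraMap O (C.E₁ ε H)) = IsLocalRing.maximalIdeal O := by
  ext a
  rw [Ideal.mem_comap, rE₁, Ideal.mem_comap, σE₁_algebraMap_O]

/-- `E₁` as an `A″_j`-algebra through `λ₀`. [folklore] -/
instance algAE₁ : Algebra (C.A'' H.hj) (C.E₁ ε H) :=
  ((algebraMap (C.E₀ ε) (C.E₁ ε H)).comp (C.lam₀ ε H)).toAlgebra

/-- The structure map of `E₁` over `A″_j` is `(E₀ → E₁) ∘ λ₀`. [folklore] -/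
theorem algebraMap_AE₁ : algebraMap (C.A'' H.hj) (C.E₁ ε H) = (algebraMap (C.E₀ ε) (C.E₁ ε H)).comp (C.lam₀ ε H) :=
  rfl

/-- The image `Z_{E,1}` of `Z_E` in `E₁`. [folklore] -/
def ZE₁ : C.E₁ ε H := algebraMap (C.E₀ ε) (C.E₁ ε H) (C.ZE ε H)

/-- Evaluation of `A″_j`-polynomials at `Z_{E,1}`. [folklore] -/
theorem aeval_ZE₁ (q : (C.A'' H.hj)[X]) :
    Polynomial.aeval (C.ZE₁ ε H) q =
      algebraMap (C.E₀ ε) (C.E₁ ε H) (Polynomial.aeval (C.ZE ε H) (q.map (C.lam₀ ε H))) := by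
  rw [Polynomial.aeval_def, Polynomial.coe_aeval_eq_eval, Polynomial.eval_map, ZE₁,
    show algebraMap (C.A'' H.hj) (C.E₁ ε H) = (algebraMap (C.E₀ ε) (C.E₁ ε H)).comp (C.lam₀ ε H)
      from rfl, Polynomial.hom_eval₂]

/-- **`Z_{E,1}` is a point of the Hensel pair in `E₁`.** [folklore] -/
theorem hasMap_ZE₁ : (C.PD e H.hj H.hje).HasMap (C.ZE₁ ε H) := by
  refine ⟨?_, ?_⟩
  · rw [C.aeval_ZE₁ ε H]
    change algebraMap (C.E₀ ε) (C.E₁ ε H)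
      (Polynomial.aeval (C.ZE ε H) ((C.pnewS e H.hj H.hje).map (C.lam₀ ε H))) = 0
    rw [C.aeval_ZE_pnewS ε H, map_zero]
  · rw [C.aeval_ZE₁ ε H]
    exact IsLocalization.Away.algebraMap_isUnit (C.gDlam ε H)

/-- **The bridge map `Λ₀ : D₀ → E₁`** (`A″_j`-algebra map with `Z ↦ Z_{E,1}`). [folklore] -/
def Λ₀ : C.D₀ e H.hj H.hje →ₐ[C.A'' H.hj] C.E₁ ε H :=
  (C.PD e H.hj H.hje).lift (C.ZE₁ ε H) (C.hasMap_ZE₁ ε H)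

/-- `Λ₀(Z) = Z_{E,1}`. [folklore] -/
theorem Λ₀_Z : C.Λ₀ ε H (C.Z e H.hj H.hje) = C.ZE₁ ε H := (C.PD e H.hj H.hje).lift_X _ _

/-- `Λ₀` on `A″_j`: `λ₀`. [folklore] -/
theorem Λ₀_algebraMap (a : C.A'' H.hj) :
    C.Λ₀ ε H (algebraMap (C.A'' H.hj) (C.D₀ e H.hj H.hje) a) =
      algebraMap (C.E₀ ε) (C.E₁ ε H) (C.lam₀ ε H a) :=
  ((C.PD e H.hj H.hje).lift (C.ZE₁ ε H) (C.hasMap_ZE₁ ε H)).commutes a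

end E1

end DecompChart

end Literature.AlgebraicGeometry.Resolution
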